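import Summits.RiemannHypothesis.RiemannHypothesis.Theorems.OddSectorOddOneSignedWindowsRobustBarta
import HarnessLib

/-!
# RH from robustly good windows (the robust form of crux `OddSector.OddOneSignedWindows`)
# (helper for item stmt-RiemannHypothesis-17778; RH-free)

With the generalised Barta inequality (`weilOddGroundEnergy_add_mul_setIntegral_ge`, sibling file
`…RobustBarta.lean`), the supersolution inequality `T_a ≥ −e(a)H_a`, `e → 0` (`stub_asmFloor`,
crux `OddBartaFloor`, stmt-17779) and the odd negativity off the line (`oddNegativityOffLine_proof`,
stmt-17780), the ROBUST form of the last crux of route `OddSector` implies RH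
(`riemannHypothesis_of_robustGoodWindows`): it suffices that beyond every height some window `a`
carries an odd-sector Weil ground state `u` with `∫_{(0,a)} Re u · H_a > 0` and weighted negative mass
`∫_{(0,a)} (Re u)⁻ (|T_a| + H_a) ≤ e′(a) ∫_{(0,a)} Re u · H_a`, `e′ → 0`. The filed crux (exact a.e.
one-signedness) is the case `e′ = 0` (`robustGoodWindows_of_oddOneSignedWindows`). Unlike exact
one-signedness, the robust condition is insensitive to the thin negative boundary layers of the
true minimiser at the resonant windows `a = log q` observed numerically (evidence
OddOneSignedWindows-finestructure.md on the item).
-/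

noncomputable section

set_option linter.dupNamespace false

open MeasureTheory Set Filter Complex
open scoped Topology ComplexConjugate

namespace Summit.RiemannHypothesis.RiemannHypothesis.Theorems.OddSector

open Literature.NumberTheory.LFunctions
open Summit.RiemannHypothesis.RiemannHypothesis.Theses.OddSector
open Summit.RiemannHypothesis.RiemannHypothesis.Theorems.OddBartaFloor

/-- **RH from robustly good windows (registered sub-goal `riemannHypothesis_of_robustGoodWindows`
of item stmt-RiemannHypothesis-17778; RH-free).** Suppose that beyond every height there is a window
`a` carrying an odd-sector Weil ground state `u` whose real part pairs positively with the odd theta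
vector on `(0,a)` and whose weighted negative mass `∫_{(0,a)} (Re u)⁻ (|T_a| + H_a)` is at most
`e′(a)` times that pairing, for some `e′ → 0`. Then the Riemann hypothesis holds: at such windows the
generalised Barta inequality and the supersolution inequality `T_a ≥ −e(a)H_a` (`stub_asmFloor`,
`e → 0`) give `ε_od(a) ≥ −e(a) − e′(a)`, whereas off-line zeros would force `ε_od(a) ≤ −η < 0` at every
large window (`oddNegativityOffLine_proof`). [folklore] -/
theorem riemannHypothesis_of_robustGoodWindows :
    (∃ e' : ℝ → ℝ, Tendsto e' atTop (nhds 0) ∧ ∀ A : ℝ, ∃ a : ℝ, A ≤ a ∧ ∃ u : ℝ → ℂ,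
      IsWeilOddGroundState a u ∧
      0 < ∫ t in Ioo 0 a, (u t).re * weilOddThetaVector a t ∧
      ∫ t in Ioo 0 a, max (-(u t).re) 0 *
          (|Summit.RiemannHypothesis.RiemannHypothesis.Theorems.OddBartaFloor.oddThetaImage a t| +
            weilOddThetaVector a t) ≤
        e' a * ∫ t in Ioo 0 a, (u t).re * weilOddThetaVector a t) →
      _root_.RiemannHypothesis := by
  rintro ⟨e', he', hwin⟩
  by_contra hRH
  obtain ⟨η, hη, A, hAneg⟩ := oddNegativityOffLine_proof hRH
  obtain ⟨a₀, e, he, hfl⟩ := stub_asmFloor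
  -- eventually `|e a| < η / 3`, `|e a| ≤ 1` and `|e' a| < η / 3`
  have hη3 : 0 < η / 3 := by positivity
  have hev : ∀ᶠ a in atTop, |e a| < min (η / 3) 1 := by
    have h1 : Tendsto (fun a => |e a|) atTop (nhds 0) := by simpa using he.abs
    exact h1.eventually (Iio_mem_nhds (lt_min hη3 one_pos))
  have hev' : ∀ᶠ a in atTop, |e' a| < η / 3 := by
    have h1 : Tendsto (fun a => |e' a|) atTop (nhds 0) := by simpa using he'.abs
    exact h1.eventually (Iio_mem_nhds hη3)
  obtain ⟨A₁, hA₁⟩ := eventually_atTop.1 (hev.and hev')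
  obtain ⟨a, ha, u, hu, hI, hD⟩ := hwin (max (max (max A a₀) A₁) 1)
  have haA : A ≤ a := le_trans (le_trans (le_trans (le_max_left _ _) (le_max_left _ _))
    (le_max_left _ _)) ha
  have ha₀ : a₀ ≤ a := le_trans (le_trans (le_trans (le_max_right _ _) (le_max_left _ _))
    (le_max_left _ _)) ha
  have haA₁ : A₁ ≤ a := le_trans (le_trans (le_max_right _ _) (le_max_left _ _)) ha
  have ha1 : 0 < a := lt_of_lt_of_le one_pos (le_trans (le_max_right _ _) ha)
  obtain ⟨h1, h2⟩ := hA₁ a haA₁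
  have he1 : |e a| ≤ 1 := (lt_of_lt_of_le h1 (min_le_right _ _)).le
  have he2 : |e a| < η / 3 := lt_of_lt_of_le h1 (min_le_left _ _)
  -- the generalised Barta inequality at `a`
  have hB := weilOddGroundEnergy_add_mul_setIntegral_ge a (e a) ha1 he1 (hfl a ha₀) u hu
  set I := ∫ t in Ioo 0 a, (u t).re * weilOddThetaVector a t with hIdef
  set D := ∫ t in Ioo 0 a, max (-(u t).re) 0 * (|oddThetaImage a t| + weilOddThetaVector a t)
    with hDdef
  -- `ε_od(a) ≥ -(e a) - e' a`
  have hε : -(e a) - e' a ≤ weilOddGroundEnergy a := by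
    have h3 : -(e' a * I) ≤ (weilOddGroundEnergy a + e a) * I := le_trans (by linarith) hB
    have h4 : 0 ≤ (weilOddGroundEnergy a + e a + e' a) * I := by nlinarith
    have h5 : 0 ≤ weilOddGroundEnergy a + e a + e' a := (mul_nonneg_iff_of_pos_right hI).1 h4
    linarith
  -- but off-line zeros force `ε_od(a) ≤ -η`
  obtain ⟨h, hh, hsupp, hodd, hnorm, hneg⟩ := hAneg a haA
  have h6 : weilOddGroundEnergy a ≤ -η := (weilOddGroundEnergy_le hh hsupp hodd hnorm).trans hneg
  have h7 : e a < η / 3 := (abs_lt.1 he2).2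
  have h8 : e' a < η / 3 := (abs_lt.1 h2).2
  linarith

/-- **The filed crux implies its robust form (registered sub-goal
`robustGoodWindows_of_oddOneSignedWindows` of item stmt-RiemannHypothesis-17778), the case `e′ = 0`:** a ground state that is real and
non-negative a.e. on `(0,a)` has zero negative mass there and pairs positively with `H_a > 0`
(it is not a.e. zero on the window, being odd and `L²`-normalised). [folklore] -/
theorem robustGoodWindows_of_oddOneSignedWindows :
    Summit.RiemannHypothesis.RiemannHypothesis.Theses.OddSector.OddOneSignedWindows →
    ∃ e' : ℝ → ℝ, Tendsto e' atTop (nhds 0) ∧ ∀ A : ℝ, ∃ a : ℝ, A ≤ a ∧ ∃ u : ℝ → ℂ,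
      IsWeilOddGroundState a u ∧
      0 < ∫ t in Ioo 0 a, (u t).re * weilOddThetaVector a t ∧
      ∫ t in Ioo 0 a, max (-(u t).re) 0 *
          (|Summit.RiemannHypothesis.RiemannHypothesis.Theorems.OddBartaFloor.oddThetaImage a t| +
            weilOddThetaVector a t) ≤
        e' a * ∫ t in Ioo 0 a, (u t).re * weilOddThetaVector a t := by
  intro hS
  refine ⟨fun _ => 0, tendsto_const_nhds, fun A => ?_⟩
  obtain ⟨a, ha, u, hu0, hsign⟩ := hS A
  have hu : IsWeilOddGroundState a u := hu0
  refine ⟨a, ha, u, hu, ?_, ?_⟩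
  · -- positivity of the pairing on `(0,a)`
    have hu2 : MemLp u 2 volume := hu.memLp
    set v : ℝ → ℝ := fun t => (u t).re with hv
    set H : ℝ → ℝ := weilOddThetaVector a with hH
    have hvmem : MemLp v 2 volume := by
      refine ⟨Complex.continuous_re.comp_aestronglyMeasurable hu2.1, ?_⟩
      refine lt_of_le_of_lt (eLpNorm_mono fun t => ?_) hu2.2
      simpa [hv, Real.norm_eq_abs] using Complex.abs_re_le_norm (u t)
    have hiH : Integrable (fun t => v t * H t) := hvmem.integrable_mul (memLp_weilOddThetaVector a 2)
    have hiH' : IntegrableOn (fun t => v t * H t) (Ioo 0 a) := hiH.integrableOn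
    have hnn : ∀ᵐ t ∂(volume.restrict (Ioo 0 a)), 0 ≤ v t * H t := by
      rw [ae_restrict_iff' measurableSet_Ioo]
      filter_upwards [hsign] with t h1 ht
      exact mul_nonneg (h1 ht).2 (weilOddThetaVector_nonneg a ht.1.le)
    rcases (setIntegral_nonneg_of_ae_restrict hnn).eq_or_lt with hz | hz'
    · exfalso
      have hvH0 : ∀ᵐ t ∂(volume.restrict (Ioo 0 a)), v t * H t = 0 := by
        have := (setIntegral_eq_zero_iff_of_nonneg_ae hnn hiH').1 hz.symm
        exact this
      rw [ae_restrict_iff' measurableSet_Ioo] at hvH0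
      -- then `u = 0` a.e. on `ℝ`
      have hodd : ∀ᵐ t : ℝ, u (-t) = -u t := hu.ae_neg
      have hzero : ∀ᵐ t : ℝ, t ∉ Icc (-a) a → u t = 0 := hu.ae_eq_zero_of_notMem
      have hnull3 : (volume : Measure ℝ) {-a, 0, a} = 0 := (Set.toFinite _).measure_zero volume
      have hae3 := measure_eq_zero_iff_ae_notMem.1 hnull3
      have hsign' : ∀ᵐ t : ℝ, -t ∈ Ioo 0 a → (u (-t)).im = 0 ∧ 0 ≤ (u (-t)).re := ae_comp_neg hsign
      have hvH0' : ∀ᵐ t : ℝ, -t ∈ Ioo 0 a → v (-t) * H (-t) = 0 := ae_comp_neg hvH0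
      have hu0 : ∀ᵐ t : ℝ, u t = 0 := by
        filter_upwards [hvH0, hvH0', hsign, hsign', hodd, hzero, hae3]
          with t h0 h0' h1 h2 h3 h5 h4
        simp only [mem_insert_iff, mem_singleton_iff, not_or] at h4
        by_cases hwin : t ∈ Icc (-a) a
        · rcases lt_trichotomy t 0 with hlt | heq | hgt
          · have hmt : -t ∈ Ioo 0 a := ⟨by linarith, by
              rcases eq_or_lt_of_le hwin.1 with h6 | h6
              · exact absurd h6.symm h4.1
              · linarith⟩
            have hH0 : H (-t) ≠ 0 := (weilOddThetaVector_pos hmt.1 hmt.2.le).ne'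
            have hvm : v (-t) = 0 := by
              rcases mul_eq_zero.1 (h0' hmt) with h7 | h7
              · exact h7
              · exact absurd h7 hH0
            have humt : u (-t) = 0 := Complex.ext hvm (h2 hmt).1
            have := h3
            rw [humt] at this
            exact neg_eq_zero.1 this.symm
          · exact absurd heq h4.2.1
          · have ht' : t ∈ Ioo 0 a := ⟨hgt, by
              rcases eq_or_lt_of_le hwin.2 with h6 | h6
              · exact absurd h6 h4.2.2
              · exact h6⟩
            have hH0 : H t ≠ 0 := (weilOddThetaVector_pos ht'.1 ht'.2.le).ne'
            have hvm : v t = 0 := by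
              rcases mul_eq_zero.1 (h0 ht') with h7 | h7
              · exact h7
              · exact absurd h7 hH0
            exact Complex.ext hvm (h1 ht').1
        · exact h5 hwin
      have hnorm := hu.integral_norm_sq
      have : ∫ t, ‖u t‖ ^ 2 = 0 := by
        rw [← integral_zero (α := ℝ)]
        exact integral_congr_ae (hu0.mono fun t ht => by simp [ht])
      linarith
    · exact hz'
  · -- zero negative mass
    have hD : ∫ t in Ioo 0 a, max (-(u t).re) 0 * (|oddThetaImage a t| + weilOddThetaVector a t) = 0 := by
      refine setIntegral_eq_zero_of_ae_eq_zero ?_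
      filter_upwards [hsign] with t h1 ht
      have : max (-(u t).re) 0 = 0 := max_eq_right (by linarith [(h1 ht).2])
      simp [this]
    rw [hD, zero_mul]

end Summit.RiemannHypothesis.RiemannHypothesis.Theorems.OddSector

end
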